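import Summits.Ventures.LatticeQCDFlow.Exactness.ReversiblePositiveTauInt
import Summits.Ventures.LatticeQCDFlow.Exactness.ReversiblePositiveThinning
import HarnessLib

/-!
# Every SECOND step of ANY reversible exact sampler is a positive sampler: even-lag autocovariances are nonnegative, nonincreasing, convex, log-convex; even windows are floors

HONEST FRAMING: exact (Metropolis-corrected) sampling algorithms for lattice gauge theory;
figures of merit are autocorrelation/cost numbers at stated couplings and volumes; no
continuum-physics claim.  (SCALAR calibration rung S0-A: not a gauge result.)

Venture `LatticeQCDFlow` (cell pub-lqcd), topic `Exactness`; FANOUT row 2 (`s0-phi4`).  NEW WORK of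
the cell in the `RevOp` format: for EVERY reversible exact sampler `K` on an admissible class (no
positivity assumed — HMC of every integrator and the local arm with ANY step law included) the
two-step operator `K² = K ∘ K` is again a reversible exact sampler on the class AND is positive,
`∫ f (K² f) w = ∫ (K f)² w ≥ 0`; hence every conclusion of `Exactness/ReversiblePositive.lean`,
`ReversiblePositiveTauInt.lean` and `ReversiblePositiveThinning.lean` holds for the chain observed
every second step.  Nothing is cited as a fact.  Printed counterpart NAMED ONLY: Geyer 1992, Statist.
Sci. 7, §3.3 (the "every other sample" chain of a reversible chain has a positive operator — there by
the spectral theorem).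

## What is proved (namespace `RevOp`; `a(k) = ∫ u (Kᵏ u) w`, `ρ(k) = a(k)/a(0)`)

* `sq_mem`, `sq_add_mul`, `sq_symm`, `sq_contr`, **`sq_pos`** — `K ∘ K` is a positive reversible exact
  sampler on the class;  `autocov_sq_eq` — its autocovariances are the even-lag ones of `K`;
* **`autocov_even_succ_le`**, **`autocov_even_convex`**, **`autocov_even_logConvex`** —
  `0 ≤ a(2k+2) ≤ a(2k)`, `a(2k+2) − a(2k+4) ≤ a(2k) − a(2k+2)`, `a(2k+2)² ≤ a(2k) a(2k+4)`:
  the even-lag autocovariance sequence of ANY observable under ANY reversible exact sampler is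
  completely tame, whatever the odd lags do;
* **`autocorr_two_pow_le`** — `ρ(2)^k ≤ ρ(2k)`;
* **`even_tauIntWindow_le`**, **`half_le_even_tauInt`** — for the chain observed every second step
  (autocorrelations `k ↦ ρ(2k)`, summable): every window is a floor of its `τ_int^{(2)}` and
  `τ_int^{(2)} ≥ ½ + ρ(2) ≥ ½` (the two-step chain of a reversible sampler is never antithetic);
* **`even_thinned_pinned`** — `(τ^{(2)} + ½)/V − ½ ≤ τ^{(2V)} ≤ ½ + (τ^{(2)} − ½)/V`.

Lattice instances (HMC every `δ`, `N`; local arm every step law) are `Exactness/Phi4TwoStep.lean`.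
NOT CLAIMED: anything about odd lags (they can be negative); any number for any run.
-/

namespace Summit.Ventures.LatticeQCDFlow.Exactness

open Real MeasureTheory Filter Finset Topology
open Summit.Ventures.LatticeQCDFlow.Scoring

namespace RevOp

variable {X : Type*} [MeasurableSpace X] {μ : Measure X} {w : X → ℝ} {A : (X → ℝ) → Prop}
  {K : (X → ℝ) → (X → ℝ)}

/-! ## §1 `K ∘ K` is a positive reversible exact sampler on the class -/

omit [MeasurableSpace X] in
/-- (stab) for `K ∘ K`. -/
theorem sq_mem (hAK : ∀ ⦃f : X → ℝ⦄, A f → A (K f)) : ∀ ⦃f : X → ℝ⦄, A f → A (K (K f)) :=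
  fun _ hf => hAK (hAK hf)

omit [MeasurableSpace X] in
/-- (lin) for `K ∘ K`. -/
theorem sq_add_mul (hAK : ∀ ⦃f : X → ℝ⦄, A f → A (K f))
    (hlin : ∀ ⦃f h : X → ℝ⦄ (c : ℝ), A f → A h →
      ∀ x, K (fun s => f s + c * h s) x = K f x + c * K h x) :
    ∀ ⦃f h : X → ℝ⦄ (c : ℝ), A f → A h →
      ∀ x, K (K (fun s => f s + c * h s)) x = K (K f) x + c * K (K h) x := by
  intro f h c hf hh x
  have h2 := iterate_add_mul hAK hlin c 2 hf hh x
  simpa only [Function.iterate_succ_apply', Function.iterate_zero, id_eq] using h2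

/-- (symm) for `K ∘ K`. -/
theorem sq_symm (hAK : ∀ ⦃f : X → ℝ⦄, A f → A (K f))
    (hsymm : ∀ ⦃f h : X → ℝ⦄, A f → A h →
      ∫ x, K f x * h x * w x ∂μ = ∫ x, f x * K h x * w x ∂μ) :
    ∀ ⦃f h : X → ℝ⦄, A f → A h →
      ∫ x, K (K f) x * h x * w x ∂μ = ∫ x, f x * K (K h) x * w x ∂μ := by
  intro f h hf hh
  have h2 := iterate_symm hAK hsymm 2 hf hh
  simpa only [Function.iterate_succ_apply', Function.iterate_zero, id_eq] using h2

/-- (contr) for `K ∘ K`. -/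
theorem sq_contr (hAK : ∀ ⦃f : X → ℝ⦄, A f → A (K f))
    (hcontr : ∀ ⦃f : X → ℝ⦄, A f → ∫ x, K f x ^ 2 * w x ∂μ ≤ ∫ x, f x ^ 2 * w x ∂μ) :
    ∀ ⦃f : X → ℝ⦄, A f → ∫ x, K (K f) x ^ 2 * w x ∂μ ≤ ∫ x, f x ^ 2 * w x ∂μ :=
  fun _ hf => (hcontr (hAK hf)).trans (hcontr hf)

/-- **(pos) for `K ∘ K`, every reversible exact sampler**: `∫ f (K(Kf)) w = ∫ (Kf)² w ≥ 0`. -/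
theorem sq_pos (hw0 : ∀ x, 0 ≤ w x) (hAK : ∀ ⦃f : X → ℝ⦄, A f → A (K f))
    (hsymm : ∀ ⦃f h : X → ℝ⦄, A f → A h →
      ∫ x, K f x * h x * w x ∂μ = ∫ x, f x * K h x * w x ∂μ) :
    ∀ ⦃f : X → ℝ⦄, A f → 0 ≤ ∫ x, f x * K (K f) x * w x ∂μ := by
  intro f hf
  rw [← hsymm hf (hAK hf)]
  exact integral_nonneg fun x => mul_nonneg (mul_self_nonneg _) (hw0 x)

omit [MeasurableSpace X] in
/-- The iterates of `K ∘ K` are the even iterates of `K`. -/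
theorem sq_iterate (u : X → ℝ) (k : ℕ) : (fun f => K (K f))^[k] u = K^[2 * k] u := by
  have e : (fun f => K (K f)) = K^[2] := by
    funext f
    simp only [Function.iterate_succ_apply', Function.iterate_zero, id_eq]
  rw [e, ← Function.iterate_mul]

/-! ## §2 Even lags of any reversible sampler -/

/-- **EVEN-LAG AUTOCOVARIANCES OF ANY REVERSIBLE SAMPLER ARE NONNEGATIVE AND NONINCREASING**:
`0 ≤ a(2k+2) ≤ a(2k)`. -/
theorem autocov_even_succ_le (hw0 : ∀ x, 0 ≤ w x)
    (hAi : ∀ ⦃f h : X → ℝ⦄, A f → A h → Integrable (fun x => f x * h x * w x) μ)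
    (hAc : ∀ ⦃f h : X → ℝ⦄ (c : ℝ), A f → A h → A (fun x => f x + c * h x))
    (hAK : ∀ ⦃f : X → ℝ⦄, A f → A (K f))
    (hlin : ∀ ⦃f h : X → ℝ⦄ (c : ℝ), A f → A h →
      ∀ x, K (fun s => f s + c * h s) x = K f x + c * K h x)
    (hsymm : ∀ ⦃f h : X → ℝ⦄, A f → A h →
      ∫ x, K f x * h x * w x ∂μ = ∫ x, f x * K h x * w x ∂μ)
    (hcontr : ∀ ⦃f : X → ℝ⦄, A f → ∫ x, K f x ^ 2 * w x ∂μ ≤ ∫ x, f x ^ 2 * w x ∂μ)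
    {u : X → ℝ} (hu : A u) (k : ℕ) :
    0 ≤ ∫ x, u x * (K^[2 * k + 2] u) x * w x ∂μ ∧
    ∫ x, u x * (K^[2 * k + 2] u) x * w x ∂μ ≤ ∫ x, u x * (K^[2 * k] u) x * w x ∂μ := by
  have h0 := autocov_nonneg_of_pos (K := fun f => K (K f)) hw0 (sq_mem hAK) (sq_symm hAK hsymm)
    (sq_pos hw0 hAK hsymm) hu (k + 1)
  have h1 := autocov_succ_le_of_pos (K := fun f => K (K f)) hw0 hAi hAc (sq_mem hAK)
    (sq_add_mul hAK hlin) (sq_symm hAK hsymm) (sq_contr hAK hcontr) (sq_pos hw0 hAK hsymm) hu k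
  rw [sq_iterate, sq_iterate] at h1
  rw [sq_iterate] at h0
  rw [show 2 * k + 2 = 2 * (k + 1) by ring]
  exact ⟨h0, h1⟩

/-- **Even lags are CONVEX and LOG-CONVEX** for any reversible sampler:
`a(2k+2) − a(2k+4) ≤ a(2k) − a(2k+2)` and `a(2k+2)² ≤ a(2k) a(2k+4)`. -/
theorem autocov_even_convex_logConvex (hw0 : ∀ x, 0 ≤ w x)
    (hAi : ∀ ⦃f h : X → ℝ⦄, A f → A h → Integrable (fun x => f x * h x * w x) μ)
    (hAc : ∀ ⦃f h : X → ℝ⦄ (c : ℝ), A f → A h → A (fun x => f x + c * h x))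
    (hAK : ∀ ⦃f : X → ℝ⦄, A f → A (K f))
    (hlin : ∀ ⦃f h : X → ℝ⦄ (c : ℝ), A f → A h →
      ∀ x, K (fun s => f s + c * h s) x = K f x + c * K h x)
    (hsymm : ∀ ⦃f h : X → ℝ⦄, A f → A h →
      ∫ x, K f x * h x * w x ∂μ = ∫ x, f x * K h x * w x ∂μ)
    {u : X → ℝ} (hu : A u) (k : ℕ) :
    (∫ x, u x * (K^[2 * k + 2] u) x * w x ∂μ) - ∫ x, u x * (K^[2 * k + 4] u) x * w x ∂μ
      ≤ (∫ x, u x * (K^[2 * k] u) x * w x ∂μ) - ∫ x, u x * (K^[2 * k + 2] u) x * w x ∂μ ∧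
    (∫ x, u x * (K^[2 * k + 2] u) x * w x ∂μ) ^ 2
      ≤ (∫ x, u x * (K^[2 * k] u) x * w x ∂μ) * ∫ x, u x * (K^[2 * k + 4] u) x * w x ∂μ := by
  have h1 := autocov_convex_of_pos (K := fun f => K (K f)) hw0 hAi hAc (sq_mem hAK)
    (sq_add_mul hAK hlin) (sq_symm hAK hsymm) (sq_pos hw0 hAK hsymm) hu k
  have h2 := autocov_logConvex_of_pos (K := fun f => K (K f)) hw0 hAi hAc (sq_mem hAK)
    (sq_add_mul hAK hlin) (sq_symm hAK hsymm) (sq_pos hw0 hAK hsymm) hu k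
  rw [sq_iterate, sq_iterate, sq_iterate] at h1 h2
  rw [show 2 * k + 2 = 2 * (k + 1) by ring, show 2 * k + 4 = 2 * (k + 2) by ring]
  exact ⟨h1, h2⟩

/-- **`ρ(2)^k ≤ ρ(2k)`** for every reversible sampler and every observable of the class. -/
theorem autocorr_two_pow_le (hw0 : ∀ x, 0 ≤ w x)
    (hAi : ∀ ⦃f h : X → ℝ⦄, A f → A h → Integrable (fun x => f x * h x * w x) μ)
    (hAc : ∀ ⦃f h : X → ℝ⦄ (c : ℝ), A f → A h → A (fun x => f x + c * h x))
    (hAK : ∀ ⦃f : X → ℝ⦄, A f → A (K f))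
    (hlin : ∀ ⦃f h : X → ℝ⦄ (c : ℝ), A f → A h →
      ∀ x, K (fun s => f s + c * h s) x = K f x + c * K h x)
    (hsymm : ∀ ⦃f h : X → ℝ⦄, A f → A h →
      ∫ x, K f x * h x * w x ∂μ = ∫ x, f x * K h x * w x ∂μ)
    {u : X → ℝ} (hu : A u) (k : ℕ) :
    ((∫ x, u x * (K^[2] u) x * w x ∂μ) / ∫ x, u x ^ 2 * w x ∂μ) ^ (k + 1)
      ≤ (∫ x, u x * (K^[2 * (k + 1)] u) x * w x ∂μ) / ∫ x, u x ^ 2 * w x ∂μ := by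
  have h := autocorr_pow_le_of_pos (K := fun f => K (K f)) hw0 hAi hAc (sq_mem hAK)
    (sq_add_mul hAK hlin) (sq_symm hAK hsymm) (sq_pos hw0 hAK hsymm) hu k
  rw [sq_iterate] at h
  simpa only [Function.iterate_succ_apply', Function.iterate_zero, id_eq] using h

/-! ## §3 The chain observed every second step -/

/-- **EVERY WINDOW OF THE TWO-STEP CHAIN IS A FLOOR, AND IT IS NEVER ANTITHETIC**: if the even-lag
series `k ↦ ρ(2k)` is summable then `τ^{(2)}_W ≤ τ^{(2)}` for every `W` and
`½ ≤ ½ + ρ(2) ≤ τ^{(2)}`. -/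
theorem even_tauIntWindow_le (hw0 : ∀ x, 0 ≤ w x)
    (hAK : ∀ ⦃f : X → ℝ⦄, A f → A (K f))
    (hsymm : ∀ ⦃f h : X → ℝ⦄, A f → A h →
      ∫ x, K f x * h x * w x ∂μ = ∫ x, f x * K h x * w x ∂μ)
    {u : X → ℝ} (hu : A u)
    (hs : Summable fun k => (∫ x, u x * (K^[2 * (k + 1)] u) x * w x ∂μ) / ∫ x, u x ^ 2 * w x ∂μ)
    (W : ℕ) :
    tauIntWindow (fun k => (∫ x, u x * (K^[2 * k] u) x * w x ∂μ) / ∫ x, u x ^ 2 * w x ∂μ) W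
      ≤ tauInt (fun k => (∫ x, u x * (K^[2 * k] u) x * w x ∂μ) / ∫ x, u x ^ 2 * w x ∂μ) ∧
    (1 / 2 ≤ 1 / 2 + (∫ x, u x * (K^[2] u) x * w x ∂μ) / (∫ x, u x ^ 2 * w x ∂μ) ∧
      1 / 2 + (∫ x, u x * (K^[2] u) x * w x ∂μ) / (∫ x, u x ^ 2 * w x ∂μ)
        ≤ tauInt (fun k => (∫ x, u x * (K^[2 * k] u) x * w x ∂μ) / ∫ x, u x ^ 2 * w x ∂μ)) := by
  have hs' : Summable fun k => (∫ x, u x * (((fun f => K (K f))^[k + 1]) u) x * w x ∂μ)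
      / ∫ x, u x ^ 2 * w x ∂μ := by
    simpa only [sq_iterate] using hs
  have h1 := tauIntWindow_le_tauInt_of_pos (K := fun f => K (K f)) hw0 (sq_mem hAK)
    (sq_symm hAK hsymm) (sq_pos hw0 hAK hsymm) hu hs' W
  have h2 := half_le_tauInt_of_pos (K := fun f => K (K f)) hw0 (sq_mem hAK)
    (sq_symm hAK hsymm) (sq_pos hw0 hAK hsymm) hu hs'
  simp only [sq_iterate] at h1 h2
  refine ⟨h1, ?_⟩
  simpa only [Function.iterate_succ_apply', Function.iterate_zero, id_eq] using h2

/-- **THINNING THE TWO-STEP CHAIN IS PINNED**: `∫ u² w > 0`, even-lag series summable, `V ≥ 1`: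
`(τ^{(2)} + ½)/V − ½ ≤ τ^{(2V)} ≤ ½ + (τ^{(2)} − ½)/V`. -/
theorem even_thinned_pinned (hw0 : ∀ x, 0 ≤ w x)
    (hAi : ∀ ⦃f h : X → ℝ⦄, A f → A h → Integrable (fun x => f x * h x * w x) μ)
    (hAc : ∀ ⦃f h : X → ℝ⦄ (c : ℝ), A f → A h → A (fun x => f x + c * h x))
    (hAK : ∀ ⦃f : X → ℝ⦄, A f → A (K f))
    (hlin : ∀ ⦃f h : X → ℝ⦄ (c : ℝ), A f → A h →
      ∀ x, K (fun s => f s + c * h s) x = K f x + c * K h x)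
    (hsymm : ∀ ⦃f h : X → ℝ⦄, A f → A h →
      ∫ x, K f x * h x * w x ∂μ = ∫ x, f x * K h x * w x ∂μ)
    (hcontr : ∀ ⦃f : X → ℝ⦄, A f → ∫ x, K f x ^ 2 * w x ∂μ ≤ ∫ x, f x ^ 2 * w x ∂μ)
    {u : X → ℝ} (hu : A u) (hP : 0 < ∫ x, u x ^ 2 * w x ∂μ) {V : ℕ} (hV : 1 ≤ V)
    (hs : Summable fun k => (∫ x, u x * (K^[2 * (k + 1)] u) x * w x ∂μ) / ∫ x, u x ^ 2 * w x ∂μ) :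
    (tauInt (fun k => (∫ x, u x * (K^[2 * k] u) x * w x ∂μ) / ∫ x, u x ^ 2 * w x ∂μ) + 1 / 2) / V
        - 1 / 2
      ≤ tauInt (fun k => (∫ x, u x * (K^[2 * (V * k)] u) x * w x ∂μ) / ∫ x, u x ^ 2 * w x ∂μ) ∧
    tauInt (fun k => (∫ x, u x * (K^[2 * (V * k)] u) x * w x ∂μ) / ∫ x, u x ^ 2 * w x ∂μ)
      ≤ 1 / 2 + (tauInt (fun k => (∫ x, u x * (K^[2 * k] u) x * w x ∂μ) / ∫ x, u x ^ 2 * w x ∂μ)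
        - 1 / 2) / V := by
  have hs' : Summable fun k => (∫ x, u x * (((fun f => K (K f))^[k + 1]) u) x * w x ∂μ)
      / ∫ x, u x ^ 2 * w x ∂μ := by
    simpa only [sq_iterate] using hs
  have h := thinned_tauInt_pinned_of_pos (K := fun f => K (K f)) hw0 hAi hAc (sq_mem hAK)
    (sq_add_mul hAK hlin) (sq_symm hAK hsymm) (sq_contr hAK hcontr) (sq_pos hw0 hAK hsymm) hu hP
    hV hs'
  simp only [sq_iterate] at h
  exact h

end RevOp

end Summit.Ventures.LatticeQCDFlow.Exactness
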